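/-
Copyright (c) 2026. Released under Apache 2.0 license.
-/
import Literature.NumberTheory.Automorphic.UnboundedDenominatorsInvariantHomRealization
import Literature.NumberTheory.EllipticCurves.ModularCurveGammaIndex
import HarnessLib

/-!
# The invariant form of CDT Cor. 4.5.3 for targets of order prime to `[SL₂(ℤ) : Γ₁(N)]`

The transfer reduction `UnboundedDenominatorsInvariantHomRealization.map_eq_one_of_mem_Gamma_mul_of_local`
with `H = Γ₁(N)`: the local condition is AUTOMATIC, because `Γ₁(N) = ⟨T⟩ · Γ(N)` and in the central extension
`G = SL₂(ℤ)/K_θ` the image of `Γ(N)` is central, so the image of `Γ₁(N)` is abelian, i.e.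
`[Γ₁(N), Γ₁(N)] ≤ K_θ` (`commutator_Gamma1_le_ker`).  Consequently:

* `cor453_invariant_form_of_coprime_index_Gamma1` — an `SL₂(ℤ)`-invariant `θ : Γ(N) → Q`, `Q` finite
  commutative of order prime to `[SL₂(ℤ) : Γ₁(N)] = N² ∏_{p ∣ N} (1 - p⁻²)`, kills `Γ(12N)`; this sharpens
  `cor453_invariant_form_of_coprime` (order prime to `12·[SL₂(ℤ):Γ(N)]`);
* `cor453_invariant_form_prime_level_of_card_pow` — **the case `N = p` prime, `Q` a `p`-group** of the invariant
  form of [CalegariDimitrovTang2025, Cor. 4.5.3] (`[SL₂(ℤ) : Γ₁(p)] = p² - 1` is prime to `p`): `θ` kills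
  `Γ(12p)`.  (These are the invariant classes in `H¹(Γ(p), ℤ/p^a)`, cf. CDT Lemma 4.5.10 for `p = 3, 5`.)

Not here: targets of order divisible by a prime dividing `p² - 1` for some `p ∣ N` (Cartan subgroups /
dicyclic Sylow `2`-subgroups), and the primes `p` with `p² ∣ N`.
-/

open scoped MatrixGroups commutatorElement

namespace Literature.NumberTheory.Automorphic

namespace UnboundedDenominators

open CongruenceSubgroup Matrix.SpecialLinearGroup ModularGroup
open Literature.NumberTheory.EllipticCurves.ModularForms (Gamma_le_Gamma1 index_gamma1_eq_card
  card_unimodular_prime_pow)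

variable {N : ℕ} {Q : Type*} [CommGroup Q]

/-- `Γ₁(N) = ⟨T⟩ · Γ(N)`: every `y ∈ Γ₁(N)` is `T^b γ` with `b = y₀₁` and `γ ∈ Γ(N)` (the kernel of
`Γ₁(N) → ℤ/N`, `γ ↦ b mod N`, is `Γ(N)`). [cite: DiamondShurman2005, §1.2 p. 14 and Exercise 1.2.3(c)] -/
theorem exists_T_zpow_mul_of_mem_Gamma1 {y : SL(2, ℤ)} (hy : y ∈ Gamma1 N) :
    ∃ (b : ℤ) (γ : SL(2, ℤ)), γ ∈ Gamma N ∧ y = T ^ b * γ := by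
  obtain ⟨h00, h11, h10⟩ := (Gamma1_mem N y).mp hy
  refine ⟨y 0 1, T ^ (-(y 0 1 : ℤ)) * y, ?_, by rw [← mul_assoc, ← zpow_add, add_neg_cancel, zpow_zero,
    one_mul]⟩
  rw [Gamma_mem]
  have e00 : ((T ^ (-(y 0 1 : ℤ)) * y) 0 0 : ℤ) = y 0 0 - y 0 1 * y 1 0 := by
    simp [coe_T_zpow, Matrix.mul_apply, Fin.sum_univ_two]; ring
  have e01 : ((T ^ (-(y 0 1 : ℤ)) * y) 0 1 : ℤ) = y 0 1 - y 0 1 * y 1 1 := by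
    simp [coe_T_zpow, Matrix.mul_apply, Fin.sum_univ_two]; ring
  have e10 : ((T ^ (-(y 0 1 : ℤ)) * y) 1 0 : ℤ) = y 1 0 := by
    simp [coe_T_zpow, Matrix.mul_apply, Fin.sum_univ_two]
  have e11 : ((T ^ (-(y 0 1 : ℤ)) * y) 1 1 : ℤ) = y 1 1 := by
    simp [coe_T_zpow, Matrix.mul_apply, Fin.sum_univ_two]
  rw [e00, e01, e10, e11]
  push_cast
  rw [h00, h11, h10]
  refine ⟨by ring, by ring, rfl, rfl⟩

/-- **`[Γ₁(N), Γ₁(N)] ≤ K_θ`** for an `SL₂(ℤ)`-invariant `θ : Γ(N) → Q`: the image of `Γ₁(N) = ⟨T⟩·Γ(N)` in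
`SL₂(ℤ)/K_θ` is generated by the image of `T` and the central image of `Γ(N)`, hence abelian.
[cite: CalegariDimitrovTang2025, Corollary 4.5.3] -/
theorem commutator_Gamma1_le_ker (θ : Gamma N →* Q)
    (hθ : ∀ (g x : SL(2, ℤ)) (hx : x ∈ Gamma N) (hgx : g * x * g⁻¹ ∈ Gamma N),
      θ ⟨g * x * g⁻¹, hgx⟩ = θ ⟨x, hx⟩) :
    ⁅Gamma1 N, Gamma1 N⁆ ≤ θ.ker.map (Gamma N).subtype := by
  haveI := ker_map_subtype_normal θ hθ
  set K : Subgroup SL(2, ℤ) := θ.ker.map (Gamma N).subtype with hKdef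
  set π : SL(2, ℤ) →* SL(2, ℤ) ⧸ K := QuotientGroup.mk' K with hπ
  -- images of elements of `Γ₁(N)` commute in the quotient
  have hcomm : ∀ a b : SL(2, ℤ), a ∈ Gamma1 N → b ∈ Gamma1 N → π a * π b = π b * π a := by
    intro a b ha hb
    obtain ⟨i, α, hα, rfl⟩ := exists_T_zpow_mul_of_mem_Gamma1 ha
    obtain ⟨j, β, hβ, rfl⟩ := exists_T_zpow_mul_of_mem_Gamma1 hb
    have hαc : ∀ g : SL(2, ℤ) ⧸ K, g * π α = π α * g :=
      Subgroup.mem_center_iff.mp (mk_mem_center_of_mem_Gamma θ hθ hα)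
    have hβc : ∀ g : SL(2, ℤ) ⧸ K, g * π β = π β * g :=
      Subgroup.mem_center_iff.mp (mk_mem_center_of_mem_Gamma θ hθ hβ)
    rw [map_mul, map_mul, map_zpow, map_zpow]
    -- `t^i zα t^j zβ = t^j zβ t^i zα` with `zα, zβ` central
    calc π T ^ i * π α * (π T ^ j * π β)
        = π T ^ i * (π T ^ j * π β * π α) := by rw [mul_assoc, ← hαc]
      _ = π T ^ j * (π T ^ i * π β) * π α := by group
      _ = π T ^ j * (π β * π T ^ i) * π α := by rw [hβc]
      _ = π T ^ j * π β * (π T ^ i * π α) := by group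
  rw [Subgroup.commutator_def, Subgroup.closure_le]
  rintro _ ⟨a, ha, b, hb, rfl⟩
  rw [SetLike.mem_coe, ← QuotientGroup.ker_mk' K, MonoidHom.mem_ker, commutatorElement_def, map_mul, map_mul,
    map_mul, map_inv, map_inv, ← hπ, hcomm a b ha hb, mul_inv_cancel_right, mul_inv_cancel]

/-- **Invariant form of CDT Cor. 4.5.3 for targets of order prime to `[SL₂(ℤ) : Γ₁(N)]`**: such an invariant
`θ : Γ(N) → Q` kills `Γ(12N)`. [cite: CalegariDimitrovTang2025, Corollary 4.5.3] -/
theorem cor453_invariant_form_of_coprime_index_Gamma1 (N : ℕ) (hN : N ≠ 0) (Q : Type*) [CommGroup Q]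
    [Finite Q] (θ : Gamma N →* Q)
    (hθ : ∀ (g x : SL(2, ℤ)) (hx : x ∈ Gamma N) (hgx : g * x * g⁻¹ ∈ Gamma N),
      θ ⟨g * x * g⁻¹, hgx⟩ = θ ⟨x, hx⟩)
    (hcop : (Nat.card Q).Coprime (Gamma1 N).index) :
    ∀ (x : SL(2, ℤ)) (hx : x ∈ Gamma N), x ∈ Gamma (12 * N) → θ ⟨x, hx⟩ = 1 := by
  haveI : NeZero N := ⟨hN⟩
  haveI := ker_map_subtype_normal θ hθ
  refine map_eq_one_of_mem_Gamma_mul_of_local θ hθ (Gamma1 N) (Gamma_le_Gamma1 N) hcop ?_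
  intro y hy hyc
  rw [sup_eq_right.mpr (commutator_Gamma1_le_ker θ hθ)] at hyc
  obtain ⟨hy', h1⟩ := (mem_ker_map_subtype_iff θ).mp hyc
  exact h1

/-- `[SL₂(ℤ) : Γ₁(p)] = (p + 1)(p - 1)` for a prime `p`. [cite: DiamondShurman2005, §1.2 p. 14] -/
theorem index_Gamma1_prime {p : ℕ} (hp : p.Prime) : (Gamma1 p).index = (p + 1) * (p - 1) := by
  haveI : NeZero p := ⟨hp.ne_zero⟩
  have h := card_unimodular_prime_pow hp Nat.one_pos
  rw [pow_one] at h
  rw [index_gamma1_eq_card, h]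
  simp

/-- **Invariant form of CDT Cor. 4.5.3 at prime level for `p`-power targets**: for a prime `p` and a finite
commutative group `Q` of order a power of `p`, every `SL₂(ℤ)`-invariant `θ : Γ(p) → Q` kills `Γ(12p)`.
(`H = Γ₁(p)` has index `p² - 1`, prime to `p`.) [cite: CalegariDimitrovTang2025, Corollary 4.5.3] -/
theorem cor453_invariant_form_prime_level_of_card_pow {p : ℕ} (hp : p.Prime) (Q : Type*) [CommGroup Q]
    [Finite Q] {a : ℕ} (hQ : Nat.card Q = p ^ a) (θ : Gamma p →* Q)
    (hθ : ∀ (g x : SL(2, ℤ)) (hx : x ∈ Gamma p) (hgx : g * x * g⁻¹ ∈ Gamma p),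
      θ ⟨g * x * g⁻¹, hgx⟩ = θ ⟨x, hx⟩) :
    ∀ (x : SL(2, ℤ)) (hx : x ∈ Gamma p), x ∈ Gamma (12 * p) → θ ⟨x, hx⟩ = 1 := by
  refine cor453_invariant_form_of_coprime_index_Gamma1 p hp.ne_zero Q θ hθ ?_
  rw [hQ, index_Gamma1_prime hp]
  have h1 : Nat.Coprime p (p + 1) := Nat.coprime_self_add_right.mpr (Nat.coprime_one_right p)
  have h2 : Nat.Coprime p (p - 1) := by
    have h : p = 1 + (p - 1) := (Nat.add_sub_cancel' hp.one_le).symm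
    conv_lhs => rw [h]
    exact Nat.coprime_add_self_left.mpr (Nat.coprime_one_left _)
  exact Nat.Coprime.pow_left a (Nat.Coprime.mul_right h1 h2)

/-- The prime-level case in the exact shape of the invariant form. [cite: CalegariDimitrovTang2025, Corollary 4.5.3] -/
theorem cor453_invariant_form_prime_level {p : ℕ} (hp : p.Prime) (Q : Type*) [CommGroup Q] [Finite Q]
    {a : ℕ} (hQ : Nat.card Q = p ^ a) (θ : Gamma p →* Q)
    (hθ : ∀ (g x : SL(2, ℤ)) (hx : x ∈ Gamma p) (hgx : g * x * g⁻¹ ∈ Gamma p),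
      θ ⟨g * x * g⁻¹, hgx⟩ = θ ⟨x, hx⟩) :
    ∃ M : ℕ, M ≠ 0 ∧ ∀ (x : SL(2, ℤ)) (hx : x ∈ Gamma p), x ∈ Gamma M → θ ⟨x, hx⟩ = 1 :=
  ⟨12 * p, Nat.mul_ne_zero (by norm_num) hp.ne_zero, cor453_invariant_form_prime_level_of_card_pow hp Q hQ θ hθ⟩

end UnboundedDenominators

end Literature.NumberTheory.Automorphic
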